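import Literature.Analysis.FluidPDE.NSEnstrophyLimit2D
import Literature.Analysis.FluidPDE.CheskidovAssemblyTools
import HarnessLib

/-!
# The Fourier–Galerkin scheme with smoothed forces and its coefficient curves; the
  two-dimensional enstrophy bound in Young's form

Trunk: FluidKinetic (`Literature/Analysis/FluidPDE`). Support file for the discharge of the named
fact `fmrt_strong_existence_torus2` (`NSStrongSolutions2D`; Foias–Manley–Rosa–Temam 2001, Ch. II
Thm. 7.4 with (7.17) and App. II.A (A.65)–(A.67); Kuksin–Shirikyan 2012, Thm. 2.1.13/2.1.18) by
the Galerkin method, for general square-integrable space–time forces: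

* `NS.exists_galerkin_scheme_curves` (every dimension) — the tree's construction of the
  Hopf–Galerkin scheme (`NS.exists_isHopfGalerkinScheme`: smoothed real force coefficients
  `g n` from `Torus.exists_smooth_realTrigPoly_approx`, global Galerkin solutions `α n` from
  `NS.exists_galerkin_solution`) repeated with the coefficient curves `g n`, `α n` and the Galerkin
  ODE **exported** (the tree's statement hides them behind `∃ N F U`), so that the 2-D enstrophy
  identity `NS.galerkin_enstrophy_identity_fin_two` (`NSGalerkinEnstrophy2D`) can be run along
  the very scheme whose limit is the Leray–Hopf solution. (`NS.exists_steady_galerkin_scheme` of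
  `NSGalerkinSteadyScheme` is the steady-force variant driven by `P_n f`.)
* `NS.galerkin_enstrophy_le_young` (`𝕋²`) — the enstrophy bound of the Galerkin solutions in
  Young's form, `‖∇U(t)‖₂² + ν∫₀ᵗ‖ΔU‖₂² ≤ ‖∇U(0)‖₂² + ν⁻¹∫₀ᵗ‖G‖₂²` for `t ≥ 0`, `ν > 0`: the
  integrated identity `½‖∇U(t)‖₂² + ν∫₀ᵗ‖ΔU‖₂² = ½‖∇U(0)‖₂² - ∫₀ᵗ∫⟪G, ΔU⟫` with
  `|∫⟪G, ΔU⟫| ≤ ‖G‖₂‖ΔU‖₂ ≤ (2ν)⁻¹‖G‖₂² + (ν/2)‖ΔU‖₂²` — the step printed between FMRT (A.65)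
  and (A.66)–(A.67).

## Mathlib / tree search

All ingredients are reused (`NS.exists_galerkin_solution`, `Torus.exists_smooth_realTrigPoly_approx`,
`NS.galerkin_test_identity`, `NS.galerkin_energy_identity`, `NS.galerkin_slice_props`,
`NS.galerkin_enstrophy_identity_fin_two`, `abs_integral_inner_le_sqrt_mul_sqrt`
(`CheskidovAssemblyTools`), `Torus.mul_le_young`); nothing new is defined.

## References

* C. Foias, O. Manley, R. Rosa, R. Temam, *Navier–Stokes Equations and Turbulence*, CUP 2001,
  Ch. II Thm. 7.4, App. II.A (A.65)–(A.67). [FoiasManleyRosaTemam2001]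
* J. C. Robinson, J. L. Rodrigo, W. Sadowski, *The three-dimensional Navier–Stokes equations*,
  CUP 2016, Thm. 4.4 Steps 1–2. [RobinsonRodrigoSadowski2016]
* S. Kuksin, A. Shirikyan, *Mathematics of Two-Dimensional Turbulence*, CUP 2012, Thm. 2.1.13,
  Thm. 2.1.18.
-/

open MeasureTheory Set Filter UnitAddTorus
open scoped ENNReal NNReal InnerProductSpace Topology

noncomputable section

namespace Literature.Analysis.FluidPDE

section NS

open FunctionSpaces.Torus Torus

variable {d : Type*} [Fintype d] [DecidableEq d]

/-! ### The scheme with smoothed forces, coefficient curves exported (every dimension) -/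

section Scheme

/-- **Hopf's Galerkin scheme with its coefficient curves.** Let `ν > 0`, `u₀ ∈ L²(T^d)` weakly
divergence free and `f` space–time measurable with `∫₀ᵀ∫‖f‖² < ∞` for every `T > 0` (the data
of `NS.hopf_existence_torus`). The construction of the tree's `NS.exists_isHopfGalerkinScheme`
(Robinson–Rodrigo–Sadowski 2016, Thm. 4.4 Steps 1–2; Constantin–Foias 1988, Ch. 8, (8.3)–(8.9);
Hopf 1951, §§2–3) — smoothed real force coefficients `g n` (`Torus.exists_smooth_realTrigPoly_approx`)
and the global Galerkin solutions `α n` from the data `(û₀(k))_{|k| ≤ n}`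
(`NS.exists_galerkin_solution`) — is repeated verbatim, **exporting** the curves `g n`, `α n`
together with the Galerkin ODE, so that identities beyond the energy identity (the 2-D enstrophy
identity `NS.galerkin_enstrophy_identity_fin_two`) can be run along the scheme. [cite: RobinsonRodrigoSadowski2016, Thm. 4.4 Steps 1–2] -/
theorem exists_galerkin_scheme_curves {ν : ℝ} (hν : 0 < ν)
    {u₀ : UnitAddTorus d → EuclideanSpace ℝ d} (hu₀ : MemLp u₀ 2 volume)
    (hdiv : FunctionSpaces.Torus.IsWeaklyDivFree u₀) {f : ℝ → UnitAddTorus d → EuclideanSpace ℝ d}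
    (hf : AEStronglyMeasurable (stLift f) (volume.restrict (Ioi 0 ×ˢ univ)))
    (hf₂ : ∀ T, 0 < T → ∫⁻ t in Ioo 0 T, ∫⁻ x, ‖f t x‖ₑ ^ 2 < ⊤) :
    ∃ (g : (n : ℕ) → ℝ → ↥(freqBall (d := d) n) → EuclideanSpace ℂ d)
      (α : (n : ℕ) → ℝ → ↥(freqBall (d := d) n) → EuclideanSpace ℂ d),
      (∀ n, Continuous (g n)) ∧ (∀ n t, IsRealCoeff (g n t)) ∧
      (∀ n, α n 0 = fun k : ↥(freqBall (d := d) n) =>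
        mFourierCoeff (FunctionSpaces.EuclideanSpace.complexify ∘ u₀) (k : d → ℤ)) ∧
      (∀ n t, α n t ∈ galerkinSubspace (freqBall n)) ∧
      (∀ n, ContinuousOn (α n) (Ici 0)) ∧
      (∀ n T, ∀ t ∈ Icc 0 T, HasDerivWithinAt (α n)
        (galerkinRHS (freqBall n) ν (g n t) (α n t)) (Icc 0 T) t) ∧
      IsHopfGalerkinScheme ν f u₀ id
        (fun n t => realTrigPoly (freqBall n) (coeffExt (freqBall n) (g n t)))
        (fun n t => realTrigPoly (freqBall n) (coeffExt (freqBall n) (α n t))) := by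
  -- the smoothed forces
  obtain ⟨g, hg_smooth, hg_real, hg_tend⟩ := exists_smooth_realTrigPoly_approx hf hf₂
  have hg_cont : ∀ n, Continuous (g n) := fun n => (hg_smooth n).continuous
  have hS : ∀ n : ℕ, ∀ k ∈ freqBall (d := d) n, -k ∈ freqBall n := fun n =>
    neg_mem_freqBall_of_mem
  -- the data of the Galerkin systems
  set c₀ : (n : ℕ) → ↥(freqBall (d := d) n) → EuclideanSpace ℂ d :=
    fun n k => mFourierCoeff (FunctionSpaces.EuclideanSpace.complexify ∘ u₀) k with hc₀_def
  have hc₀ : ∀ n, c₀ n ∈ galerkinSubspace (freqBall (d := d) n) := fun n =>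
    ⟨isRealCoeff_mFourierCoeff (hu₀.integrable one_le_two),
      isSolenoidalCoeff_restrict (hdiv.isTransversal_mFourierCoeff hu₀ (freqBall n))⟩
  -- the global Galerkin solutions
  have hsol : ∀ n : ℕ, ∃ α : ℝ → ↥(freqBall (d := d) n) → EuclideanSpace ℂ d,
      α 0 = c₀ n ∧ (∀ t, α t ∈ galerkinSubspace (freqBall n)) ∧ ContinuousOn α (Ici 0) ∧
      ∀ T, ∀ t ∈ Icc 0 T, HasDerivWithinAt α (galerkinRHS (freqBall n) ν (g n t) (α t))
        (Icc 0 T) t := fun n =>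
    exists_galerkin_solution ν hν.le (hS n) (hg_cont n) (hg_real n) (hc₀ n)
  choose α hα0 hαmem hαcont hαderiv using hsol
  refine ⟨g, α, hg_cont, hg_real, hα0, hαmem, hαcont, hαderiv, ?_⟩
  have hU0 : ∀ n, realTrigPoly (freqBall n) (coeffExt (freqBall n) (α n 0)) =
      fourierTruncate n u₀ := by
    intro n
    rw [hα0 n, fourierTruncate_eq]
    exact realTrigPoly_coeffExt_restrict _
  have hband : ∀ {n : ℕ} {a : UnitAddTorus d → EuclideanSpace ℝ d}, IsGalerkinMode n a →
      ∀ k ∉ freqBall (d := d) n,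
        mFourierCoeff (FunctionSpaces.EuclideanSpace.complexify ∘ a) k = 0 :=
    fun ha k hk => ha.mFourierCoeff_eq_zero (not_mem_freqBall.1 hk)
  exact
    { tendsto_order := tendsto_id
      smooth_force := fun n => contDiff_stLift_realTrigPoly (hg_smooth n)
      tendsto_force := hg_tend
      continuousOn := fun n => continuousOn_stLift_realTrigPoly (hαcont n)
      isGalerkinMode := fun n t _ =>
        have h := galerkin_slice_props (hS n) (hαmem n t)
        ⟨h.1, h.2.1, fun k hk => h.2.2.2 k (not_mem_freqBall.2 hk)⟩
      isWeaklyDivFree := fun n t _ => (galerkin_slice_props (hS n) (hαmem n t)).2.2.1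
      galerkin := fun n a ha s t hs hst =>
        galerkin_test_identity ν (hS n) (hg_cont n) (hg_real n) (hαmem n) (hαderiv n)
          ha.isSmooth ha.isDivFree (hband ha) hs hst
      energy_eq := fun n s t hs hst =>
        galerkin_energy_identity ν (hS n) (hg_cont n) (hg_real n) (hαmem n) (hαderiv n) hs hst
      initial_inner := fun n a ha => by
        rw [hU0 n]
        exact integral_inner_fourierTruncate_eq hu₀ (ha.isSmooth.memLp 2) (hband ha)
      tendsto_initial := by
        have heq : (fun n => eLpNorm (realTrigPoly (freqBall n) (coeffExt (freqBall n) (α n 0)) -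
            u₀) 2 volume) = fun n => eLpNorm (fourierTruncate n u₀ - u₀) 2 volume := by
          funext n; rw [hU0 n]
        rw [heq]
        exact tendsto_eLpNorm_fourierTruncate_sub hu₀ }

end Scheme

/-! ### Two dimensions: the enstrophy bound of the Galerkin solutions in Young's form -/

section Young

variable {S : Finset (Fin 2 → ℤ)}

/-- `∫ ‖G‖²` of a Galerkin state is the finite sum `∑_k ‖g k‖²` (Parseval). [folklore] -/
theorem integral_norm_sq_galerkin {d : Type*} [Fintype d] {S : Finset (d → ℤ)}
    (hS : ∀ k ∈ S, -k ∈ S) {c : ↥S → EuclideanSpace ℂ d} (hc : IsRealCoeff c) :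
    ∫ x, ‖realTrigPoly S (coeffExt S c) x‖ ^ 2 = ∑ k : ↥S, ‖c k‖ ^ 2 := by
  rw [integral_norm_sq_realTrigPoly hS (hc.isConjSymm_coeffExt hS), sum_coeffExt (fun _ v => ‖v‖ ^ 2)]

/-- `∫ ‖ΔU‖²` of a Galerkin state is its spectral Laplacian norm `(eLaplacianNormSq U).toReal`
(`ΔU` is the real trigonometric polynomial with coefficients `-4π²|k|² c k`; Parseval). [folklore] -/
theorem integral_norm_sq_laplacian_galerkin {d : Type*} [Fintype d] [DecidableEq d]
    {S : Finset (d → ℤ)} (hS : ∀ k ∈ S, -k ∈ S) {c : ↥S → EuclideanSpace ℂ d} (hc : IsRealCoeff c) :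
    ∫ x, ‖laplacian (realTrigPoly S (coeffExt S c)) x‖ ^ 2 =
      (eLaplacianNormSq (realTrigPoly S (coeffExt S c))).toReal := by
  have hlap : laplacian (realTrigPoly S (coeffExt S c)) = realTrigPoly S
      (fun k => -(((4 * Real.pi ^ 2 * freqNormSq k : ℝ) : ℂ) • coeffExt S c k)) :=
    funext fun x => laplacian_realTrigPoly S _ x
  rw [hlap, integral_norm_sq_realTrigPoly hS
    (isConjSymm_laplacianCoeff (hc.isConjSymm_coeffExt hS)),
    toReal_eLaplacianNormSq_realTrigPoly hS (hc.isConjSymm_coeffExt hS), Finset.mul_sum]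
  refine Finset.sum_congr rfl fun k _ => ?_
  rw [norm_neg, norm_smul, Complex.norm_real, Real.norm_of_nonneg
    (mul_nonneg (by positivity) (freqNormSq_nonneg k))]
  ring

/-- **The enstrophy bound of 2-D Galerkin solutions, Young's form** (Foias–Manley–Rosa–Temam
2001, App. II.A: from (A.65) `½ d/dt‖u‖² + ν|Au|² = (f, Au)` with
`(f, Au) ≤ ½ν|Au|² + ½ν⁻¹|f|²`, the step printed between (A.65) and (A.66)–(A.67); Kuksin–
Shirikyan 2012, proof of Thm. 2.1.18). Along a Galerkin solution on `𝕋²` with continuous real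
force coefficients `g`, for `ν > 0` and `t ≥ 0`:
`‖∇U(t)‖₂² + ν∫₀ᵗ‖ΔU‖₂² ≤ ‖∇U(0)‖₂² + ν⁻¹∫₀ᵗ‖G‖₂²` (real form; the `∫₀ᵗ‖ΔU‖₂²` written as
the `toReal` of the time `lintegral` of `eLaplacianNormSq`). [cite: FoiasManleyRosaTemam2001, App. II.A (A.65)–(A.67)] -/
theorem galerkin_enstrophy_le_young {ν : ℝ} (hν : 0 < ν) (hS : ∀ k ∈ S, -k ∈ S)
    {g : ℝ → ↥S → EuclideanSpace ℂ (Fin 2)} (hg : Continuous g) (hgr : ∀ t, IsRealCoeff (g t))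
    {α : ℝ → ↥S → EuclideanSpace ℂ (Fin 2)} (hmem : ∀ t, α t ∈ galerkinSubspace S)
    (hα : ∀ T, ∀ t ∈ Icc 0 T, HasDerivWithinAt α (galerkinRHS S ν (g t) (α t)) (Icc 0 T) t)
    {t : ℝ} (ht : 0 ≤ t) :
    (eGradNormSq (realTrigPoly S (coeffExt S (α t)))).toReal +
        ν * (∫⁻ τ in Ioo 0 t, eLaplacianNormSq (realTrigPoly S (coeffExt S (α τ)))).toReal ≤
      (eGradNormSq (realTrigPoly S (coeffExt S (α 0)))).toReal +
        ν⁻¹ * ∫ τ in (0 : ℝ)..t, ∫ x, ‖realTrigPoly S (coeffExt S (g τ)) x‖ ^ 2 := by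
  have hid := galerkin_enstrophy_identity_fin_two ν hS hg hgr hmem hα le_rfl ht
  -- the three time integrands
  set Lap : ℝ → ℝ := fun τ => (eLaplacianNormSq (realTrigPoly S (coeffExt S (α τ)))).toReal
    with hLap
  set X : ℝ → ℝ := fun τ => ∫ x, ‖realTrigPoly S (coeffExt S (g τ)) x‖ ^ 2 with hX
  set P : ℝ → ℝ := fun τ => ∫ x, ⟪realTrigPoly S (coeffExt S (g τ)) x,
      laplacian (realTrigPoly S (coeffExt S (α τ))) x⟫_ℝ with hP
  have hα_cont : ContinuousOn α (Icc 0 t) := fun τ hτ => (hα t τ hτ).continuousWithinAt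
  -- pointwise Young: `-P ≤ (2ν)⁻¹ X + (ν/2) Lap`
  have hyoung : ∀ {p x l : ℝ}, |p| ≤ Real.sqrt x * Real.sqrt l → 0 ≤ x → 0 ≤ l →
      -p ≤ (2 * ν)⁻¹ * x + ν / 2 * l := by
    intro p x l h hx hl
    have h2 := mul_le_young (Real.sqrt l) (Real.sqrt x) hν
    rw [Real.sq_sqrt hx, Real.sq_sqrt hl] at h2
    nlinarith [neg_abs_le p, mul_comm (Real.sqrt x) (Real.sqrt l)]
  have hpt : ∀ τ, -P τ ≤ (2 * ν)⁻¹ * X τ + ν / 2 * Lap τ := by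
    intro τ
    have hG : MemLp (realTrigPoly S (coeffExt S (g τ))) 2 volume := memLp_realTrigPoly _ _ 2
    have hL : MemLp (laplacian (realTrigPoly S (coeffExt S (α τ)))) 2 volume :=
      (isSmooth_realTrigPoly _ _).laplacian.memLp 2
    have h1 : |P τ| ≤ Real.sqrt (X τ) * Real.sqrt (Lap τ) := by
      have h := abs_integral_inner_le_sqrt_mul_sqrt hG hL
      rw [integral_norm_sq_laplacian_galerkin hS (hmem τ).1] at h
      exact h
    exact hyoung h1 (integral_nonneg fun _ => sq_nonneg _) ENNReal.toReal_nonneg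
  -- continuity (Fourier side) and integrability on `[0, t]`
  have hLap_eq : ∀ τ, Lap τ = 16 * Real.pi ^ 4 *
      ∑ k : ↥S, freqNormSq (k : Fin 2 → ℤ) ^ 2 * ‖α τ k‖ ^ 2 := fun τ =>
    toReal_eLaplacianNormSq_coeffExt hS (hmem τ).1
  have hLap_cont : ContinuousOn Lap (Icc 0 t) := by
    rw [funext hLap_eq]
    refine continuousOn_const.mul (continuousOn_finsetSum _ fun k _ => ?_)
    exact continuousOn_const.mul (((continuous_apply k).comp_continuousOn hα_cont).norm.pow 2)
  have hX_eq : ∀ τ, X τ = ∑ k : ↥S, ‖g τ k‖ ^ 2 := fun τ => integral_norm_sq_galerkin hS (hgr τ)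
  have hX_cont : Continuous X := by
    rw [funext hX_eq]
    exact continuous_finsetSum _ fun k _ => ((continuous_apply k).comp hg).norm.pow 2
  have hP_eq : ∀ τ, P τ = ∑ k : ↥S, (inner ℂ (g τ k)
      (-(((4 * Real.pi ^ 2 * freqNormSq (k : Fin 2 → ℤ) : ℝ) : ℂ) • α τ k))).re := fun τ =>
    integral_inner_realTrigPoly_laplacian_eq_sum hS (hgr τ) (hmem τ).1
  have hP_cont : ContinuousOn P (Icc 0 t) := by
    rw [funext hP_eq]
    refine continuousOn_finsetSum _ fun k _ => Complex.continuous_re.comp_continuousOn ?_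
    refine ((continuous_apply k).comp hg).continuousOn.inner ?_
    exact (((continuous_apply k).comp_continuousOn hα_cont).const_smul
      (((4 * Real.pi ^ 2 * freqNormSq (k : Fin 2 → ℤ) : ℝ) : ℂ))).neg
  have hIcc : uIcc 0 t = Icc 0 t := uIcc_of_le ht
  have hLap_int : IntervalIntegrable Lap volume 0 t := (hLap_cont.mono hIcc.subset).intervalIntegrable
  have hX_int : IntervalIntegrable X volume 0 t := hX_cont.intervalIntegrable _ _
  have hP_int : IntervalIntegrable P volume 0 t := (hP_cont.mono hIcc.subset).intervalIntegrable
  -- integrate the pointwise bound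
  have hint : -∫ τ in (0 : ℝ)..t, P τ ≤
      (2 * ν)⁻¹ * (∫ τ in (0 : ℝ)..t, X τ) + ν / 2 * ∫ τ in (0 : ℝ)..t, Lap τ := by
    rw [← intervalIntegral.integral_neg, ← intervalIntegral.integral_const_mul,
      ← intervalIntegral.integral_const_mul,
      ← intervalIntegral.integral_add (hX_int.const_mul _) (hLap_int.const_mul _)]
    exact intervalIntegral.integral_mono_on ht hP_int.neg
      ((hX_int.const_mul _).add (hLap_int.const_mul _)) fun τ _ => hpt τ
  -- the dissipation as a `lintegral`
  have hlint : (∫⁻ τ in Ioo 0 t, eLaplacianNormSq (realTrigPoly S (coeffExt S (α τ)))).toReal =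
      ∫ τ in (0 : ℝ)..t, Lap τ := by
    have heq : ∀ τ, eLaplacianNormSq (realTrigPoly S (coeffExt S (α τ))) =
        ENNReal.ofReal (Lap τ) := fun τ => by
      rw [hLap_eq, eLaplacianNormSq_coeffExt hS (hmem τ).1]
    simp_rw [heq]
    have hint' : IntegrableOn Lap (Ioo 0 t) volume :=
      (hLap_cont.integrableOn_compact isCompact_Icc).mono_set Ioo_subset_Icc_self
    have hnn' : ∀ τ, 0 ≤ Lap τ := fun τ => ENNReal.toReal_nonneg
    rw [← ofReal_integral_eq_lintegral_ofReal hint' (ae_of_all _ hnn'), ENNReal.toReal_ofReal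
      (integral_nonneg hnn'), intervalIntegral.integral_of_le ht, integral_Ioc_eq_integral_Ioo]
  rw [hlint] at hid ⊢
  have hPint_eq : ∫ τ in (0 : ℝ)..t, ∫ x, ⟪realTrigPoly S (coeffExt S (g τ)) x,
      laplacian (realTrigPoly S (coeffExt S (α τ))) x⟫_ℝ = ∫ τ in (0 : ℝ)..t, P τ := rfl
  rw [hPint_eq] at hid
  have hXint_eq : ∫ τ in (0 : ℝ)..t, ∫ x, ‖realTrigPoly S (coeffExt S (g τ)) x‖ ^ 2 =
      ∫ τ in (0 : ℝ)..t, X τ := rfl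
  rw [hXint_eq]
  have hL0 : 0 ≤ ∫ τ in (0 : ℝ)..t, Lap τ :=
    intervalIntegral.integral_nonneg ht fun τ _ => ENNReal.toReal_nonneg
  have hX0 : 0 ≤ ∫ τ in (0 : ℝ)..t, X τ :=
    intervalIntegral.integral_nonneg ht fun τ _ => integral_nonneg fun _ => sq_nonneg _
  have hkey : ν * ∫ τ in (0 : ℝ)..t, Lap τ ≤
      (eGradNormSq (realTrigPoly S (coeffExt S (α 0)))).toReal -
        (eGradNormSq (realTrigPoly S (coeffExt S (α t)))).toReal + ν⁻¹ * ∫ τ in (0 : ℝ)..t, X τ := by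
    have h2 : (2 * ν)⁻¹ * (∫ τ in (0 : ℝ)..t, X τ) = 2⁻¹ * (ν⁻¹ * ∫ τ in (0 : ℝ)..t, X τ) := by
      rw [mul_inv]; ring
    rw [h2] at hint
    nlinarith [hint, hid]
  linarith

end Young

end NS

end Literature.Analysis.FluidPDE

end
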